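import Literature.MathematicalPhysics.QuantumFieldTheory.ConformalBootstrap3D.PointKernelK34L505Data
import Literature.MathematicalPhysics.QuantumFieldTheory.ConformalBootstrap3D.PointKernelK34L505Segs

/-!
# K34L505 certificate, kernel block file E4: `ε`-row segments (interval coefficient rule; block checker `PCert.hBlockOKI` of `PointKernelInterval`, soundness `PCert.hBlockOKI_sound`), segments `29 ≤ i < 33`

`decide` by kernel reduction (no `native_decide`, no extra axioms) on the literal data of
`PointKernelK34L505Data`, on the certificate itself (full `s`-width) or on its piece certificates
`pcP_i = certK34L505.withS σ_i σ_(i+1) …` (the cell numbers on an `s`-piece; assembled by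
`CellFactIS_of_pieces`).  Estimated kernel time 232 s (7 theorems).
-/

set_option maxRecDepth 100000
set_option maxHeartbeats 0

namespace Literature.MathematicalPhysics.QuantumFieldTheory.ConformalBootstrap3D.PointKernelK34L505

open Literature.MathematicalPhysics.QuantumFieldTheory.ConformalBootstrap3D.PointKernel

/-- segment 29 of `esegsK34L505` passes the kernel evaluator on piece 1 of the 2-piece `s`-cover (≈26 s of kernel work). [folklore] -/
theorem eBlock_29_2_1 : pc2_1K34L505.hBlockOKI esegsK34L505 29 30 JEK34L505 = true := by
  decide +kernel

/-- segment 30 of `esegsK34L505` passes the kernel evaluator on piece 0 of the 2-piece `s`-cover (≈26 s of kernel work). [folklore] -/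
theorem eBlock_30_2_0 : pc2_0K34L505.hBlockOKI esegsK34L505 30 31 JEK34L505 = true := by
  decide +kernel

/-- segment 30 of `esegsK34L505` passes the kernel evaluator on piece 1 of the 2-piece `s`-cover (≈26 s of kernel work). [folklore] -/
theorem eBlock_30_2_1 : pc2_1K34L505.hBlockOKI esegsK34L505 30 31 JEK34L505 = true := by
  decide +kernel

/-- segment 31 of `esegsK34L505` passes the kernel evaluator on piece 0 of the 2-piece `s`-cover (≈36 s of kernel work). [folklore] -/
theorem eBlock_31_2_0 : pc2_0K34L505.hBlockOKI esegsK34L505 31 32 JEK34L505 = true := by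
  decide +kernel

/-- segment 31 of `esegsK34L505` passes the kernel evaluator on piece 1 of the 2-piece `s`-cover (≈36 s of kernel work). [folklore] -/
theorem eBlock_31_2_1 : pc2_1K34L505.hBlockOKI esegsK34L505 31 32 JEK34L505 = true := by
  decide +kernel

/-- segment 32 of `esegsK34L505` passes the kernel evaluator on piece 0 of the 4-piece `s`-cover (≈36 s of kernel work). [folklore] -/
theorem eBlock_32_4_0 : pc4_0K34L505.hBlockOKI esegsK34L505 32 33 JEK34L505 = true := by
  decide +kernel

/-- segment 32 of `esegsK34L505` passes the kernel evaluator on piece 1 of the 4-piece `s`-cover (≈36 s of kernel work). [folklore] -/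
theorem eBlock_32_4_1 : pc4_1K34L505.hBlockOKI esegsK34L505 32 33 JEK34L505 = true := by
  decide +kernel

end Literature.MathematicalPhysics.QuantumFieldTheory.ConformalBootstrap3D.PointKernelK34L505
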